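import Mathlib
import Literature.Computability.AlgebraicComplexity.NewtonPolygonTauProductBounds
import Summits.ValiantsHypothesis.ValiantsHypothesis.Theorems.NewtonUnitEquationsDissociatedUniformTotalsLawDominance
import HarnessLib

/-!
# Crux `NewtonUnitEquations.DissociatedUniform` (stmt-ValiantsHypothesis-5905), `n = 3` totals law of model (Q**):
# FULL-GRID DOMINANCE — the located log-free rung behind the box strata (`GridDominanceBound C`), with its `log` form proved

Memo `Cruxes/DissociatedUniform/NOTES-t1g18.md` §2–§3.  The box / digit-box / Bohr strata (`…TotalsLawBoxWindows`, `…BoxUnion`, `…BohrBox`)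
are proved up to a factor `log` through the dominance hull bound `…TotalsLawDominance.Stair.ncard_extremePoints_domPts_le`.  Memo §2 shows
that GENERAL dominance sums (and already interval systems) are NOT linear — in the stiff regime they are upper envelopes of line segments,
which reach `Ω(n·α(n))` pieces (Wiernik–Sharir 1988) — so the located conjecture "DominanceLinear" of `NOTES-t1g17.md` is false
asymptotically.  What the block reduction of the box strata actually produces is more special: FULL-GRID dominance sums — rows and columns
BOTH indexed by the key grid `[m₁] × [m₂]`, one point each, relation `k ≤ c` coordinatewise — where the segment embedding needs an antichain of
columns and therefore pays `m₁m₂ ≈ n²` for `n` active rows.  This file types the surviving located rung and proves its logarithmic form: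
* `Stair.gridPts m₁ m₂ v b` — the full-grid dominance sum `{v k + b c : k, c ∈ Fin m₁ × Fin m₂, k.1 ≤ c.1, k.2 ≤ c.2}`;
* `@[conjecture] GridDominanceBound C` — `#vert conv(gridPts) ≤ C·m₁m₂` for all `m₁, m₂, v, b` (OPEN; would make the box strata log-free);
* `Stair.gridPts_eq_domPts` + `Stair.ncard_extremePoints_gridPts_le_log` — the PROVED form
  `#vert conv(gridPts) ≤ 8·size(2(m₁m₂+1)(m₂+1))·m₁m₂ = O(m₁m₂·log(m₁m₂))` (an instance of the dominance bound with lexicographic codes);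
* `gridDominanceBound_mono`, `not_gridDominanceBound_zero`.
Honest label: a located conjecture-grade statement plus its known `log` form; `UnionTotalsLaw C`, `TriWordsBound C`, `TotalsLawThree C` remain
OPEN and are asserted nowhere; nothing here bears on VP ≠ VNP. [folklore]
-/

set_option linter.dupNamespace false -- `ValiantsHypothesis.ValiantsHypothesis` (summit = problem) in every name

open Finset Matrix
open scoped Pointwise

namespace Summit.ValiantsHypothesis.ValiantsHypothesis.Theorems.NewtonUnitEquationsDissociatedUniform

namespace TotalsLaw

namespace Stair

open Literature.Computability.AlgebraicComplexity.KPTT.PlanarMinkowski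

/-- The FULL-GRID dominance sum `{v k + b c : k, c ∈ Fin m₁ × Fin m₂, k.1 ≤ c.1 ∧ k.2 ≤ c.2}` (one row point per key, one column point
per cell). -/
noncomputable def gridPts (m₁ m₂ : ℕ) (v b : Fin m₁ × Fin m₂ → (Fin 2 → ℝ)) : Finset (Fin 2 → ℝ) :=
  ((Finset.univ ×ˢ Finset.univ : Finset ((Fin m₁ × Fin m₂) × (Fin m₁ × Fin m₂))).filter
      fun p => p.1.1 ≤ p.2.1 ∧ p.1.2 ≤ p.2.2).image fun p => v p.1 + b p.2

/-- Membership in `gridPts`. [folklore] -/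
theorem mem_gridPts {m₁ m₂ : ℕ} {v b : Fin m₁ × Fin m₂ → (Fin 2 → ℝ)} {x : Fin 2 → ℝ} :
    x ∈ gridPts m₁ m₂ v b ↔ ∃ k c : Fin m₁ × Fin m₂, k.1 ≤ c.1 ∧ k.2 ≤ c.2 ∧ v k + b c = x := by
  constructor
  · intro hx
    obtain ⟨p, hp, rfl⟩ := Finset.mem_image.1 hx
    obtain ⟨-, h1, h2⟩ := Finset.mem_filter.1 hp
    exact ⟨p.1, p.2, h1, h2, rfl⟩
  · rintro ⟨k, c, h1, h2, rfl⟩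
    exact Finset.mem_image.2
      ⟨(k, c), Finset.mem_filter.2 ⟨Finset.mem_product.2 ⟨Finset.mem_univ _, Finset.mem_univ _⟩, h1, h2⟩, rfl⟩

/-! ### Lexicographic codes: the grid sum is a dominance sum -/

section Codes

variable {m₁ m₂ : ℕ}

/-- Second row position: `2M·k.2 + e k` with `e` an enumeration of the grid and `M = m₁m₂ + 1` (injective). -/
noncomputable def gRow₂ (k : Fin m₁ × Fin m₂) : ℕ :=
  2 * (m₁ * m₂ + 1) * (k.2 : ℕ) + (Fintype.equivFin (Fin m₁ × Fin m₂) k : ℕ)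

/-- Second column position: `2M·c.2 + M + e c` (injective; `gRow₂ k < gCol₂ c ↔ k.2 ≤ c.2`). -/
noncomputable def gCol₂ (c : Fin m₁ × Fin m₂) : ℕ :=
  2 * (m₁ * m₂ + 1) * (c.2 : ℕ) + (m₁ * m₂ + 1) + (Fintype.equivFin (Fin m₁ × Fin m₂) c : ℕ)

/-- The enumeration index is `< m₁m₂ + 1`. [folklore] -/
private theorem enum_lt (k : Fin m₁ × Fin m₂) : (Fintype.equivFin (Fin m₁ × Fin m₂) k : ℕ) < m₁ * m₂ + 1 := by
  have h := (Fintype.equivFin (Fin m₁ × Fin m₂) k).isLt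
  have hc : Fintype.card (Fin m₁ × Fin m₂) = m₁ * m₂ := by
    rw [Fintype.card_prod, Fintype.card_fin, Fintype.card_fin]
  omega

/-- `gRow₂ k < gCol₂ c ↔ k.2 ≤ c.2`. [folklore] -/
theorem gRow₂_lt_gCol₂_iff (k c : Fin m₁ × Fin m₂) : gRow₂ k < gCol₂ c ↔ k.2 ≤ c.2 := by
  unfold gRow₂ gCol₂
  have hk := enum_lt k
  have hc := enum_lt c
  set M := m₁ * m₂ + 1 with hM
  constructor
  · intro h
    rw [Fin.le_iff_val_le_val]
    by_contra hlt
    push Not at hlt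
    have h1 : 2 * M * ((c.2 : ℕ) + 1) ≤ 2 * M * (k.2 : ℕ) := Nat.mul_le_mul_left _ (by omega)
    nlinarith
  · intro h
    have h0 := Fin.le_iff_val_le_val.1 h
    have h1 : 2 * M * (k.2 : ℕ) ≤ 2 * M * (c.2 : ℕ) := Nat.mul_le_mul_left _ h0
    omega

/-- `gRow₂` is injective. [folklore] -/
theorem gRow₂_injective : Function.Injective (gRow₂ (m₁ := m₁) (m₂ := m₂)) := by
  intro k k' h
  unfold gRow₂ at h
  have hk := enum_lt k
  have hk' := enum_lt k'
  set M := m₁ * m₂ + 1 with hM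
  have hmod : (Fintype.equivFin (Fin m₁ × Fin m₂) k : ℕ) = (Fintype.equivFin (Fin m₁ × Fin m₂) k' : ℕ) := by
    have h1 : (2 * M * (k.2 : ℕ) + (Fintype.equivFin (Fin m₁ × Fin m₂) k : ℕ)) % (2 * M) =
        (2 * M * (k'.2 : ℕ) + (Fintype.equivFin (Fin m₁ × Fin m₂) k' : ℕ)) % (2 * M) := by rw [h]
    rwa [Nat.mul_add_mod, Nat.mul_add_mod, Nat.mod_eq_of_lt (by omega : _ < 2 * M),
      Nat.mod_eq_of_lt (by omega : _ < 2 * M)] at h1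
  exact (Fintype.equivFin (Fin m₁ × Fin m₂)).injective (Fin.ext hmod)

/-- `gCol₂` is injective. [folklore] -/
theorem gCol₂_injective : Function.Injective (gCol₂ (m₁ := m₁) (m₂ := m₂)) := by
  intro c c' h
  unfold gCol₂ at h
  have hc := enum_lt c
  have hc' := enum_lt c'
  set M := m₁ * m₂ + 1 with hM
  have hmod : (Fintype.equivFin (Fin m₁ × Fin m₂) c : ℕ) = (Fintype.equivFin (Fin m₁ × Fin m₂) c' : ℕ) := by
    have e1 : 2 * M * (c.2 : ℕ) + (M + (Fintype.equivFin (Fin m₁ × Fin m₂) c : ℕ)) =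
        2 * M * (c.2 : ℕ) + M + (Fintype.equivFin (Fin m₁ × Fin m₂) c : ℕ) := (Nat.add_assoc _ _ _).symm
    have e2 : 2 * M * (c'.2 : ℕ) + (M + (Fintype.equivFin (Fin m₁ × Fin m₂) c' : ℕ)) =
        2 * M * (c'.2 : ℕ) + M + (Fintype.equivFin (Fin m₁ × Fin m₂) c' : ℕ) := (Nat.add_assoc _ _ _).symm
    have h1 : (2 * M * (c.2 : ℕ) + (M + (Fintype.equivFin (Fin m₁ × Fin m₂) c : ℕ))) % (2 * M) =
        (2 * M * (c'.2 : ℕ) + (M + (Fintype.equivFin (Fin m₁ × Fin m₂) c' : ℕ))) % (2 * M) := by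
      rw [e1, e2, h]
    rw [Nat.mul_add_mod, Nat.mul_add_mod, Nat.mod_eq_of_lt (by omega : _ < 2 * M),
      Nat.mod_eq_of_lt (by omega : _ < 2 * M)] at h1
    omega
  exact (Fintype.equivFin (Fin m₁ × Fin m₂)).injective (Fin.ext hmod)

/-- Second column positions are `< 2(m₁m₂ + 1)(m₂ + 1)`. [folklore] -/
theorem gCol₂_lt (c : Fin m₁ × Fin m₂) : gCol₂ c < 2 * (m₁ * m₂ + 1) * (m₂ + 1) := by
  unfold gCol₂
  have hc := enum_lt c
  have h2 := c.2.isLt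
  have h1 : 2 * (m₁ * m₂ + 1) * (c.2 : ℕ) ≤ 2 * (m₁ * m₂ + 1) * (m₂ - 1) := Nat.mul_le_mul_left _ (by omega)
  have h3 : 2 * (m₁ * m₂ + 1) * (m₂ - 1) + 2 * (m₁ * m₂ + 1) * 2 = 2 * (m₁ * m₂ + 1) * (m₂ + 1) := by
    rw [← Nat.mul_add]; congr 1; omega
  omega

/-- Injective refinement of the first row position: `2M·k.1 + e k`. -/
noncomputable def gRow₁' (k : Fin m₁ × Fin m₂) : ℕ :=
  2 * (m₁ * m₂ + 1) * (k.1 : ℕ) + (Fintype.equivFin (Fin m₁ × Fin m₂) k : ℕ)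

/-- Injective refinement of the first column position. -/
noncomputable def gCol₁' (c : Fin m₁ × Fin m₂) : ℕ :=
  2 * (m₁ * m₂ + 1) * (c.1 : ℕ) + (m₁ * m₂ + 1) + (Fintype.equivFin (Fin m₁ × Fin m₂) c : ℕ)

/-- `gRow₁' k < gCol₁' c ↔ k.1 ≤ c.1`. [folklore] -/
theorem gRow₁'_lt_gCol₁'_iff (k c : Fin m₁ × Fin m₂) : gRow₁' k < gCol₁' c ↔ k.1 ≤ c.1 := by
  unfold gRow₁' gCol₁'
  have hk := enum_lt k
  have hc := enum_lt c
  set M := m₁ * m₂ + 1 with hM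
  constructor
  · intro h
    rw [Fin.le_iff_val_le_val]
    by_contra hlt
    push Not at hlt
    have h1 : 2 * M * ((c.1 : ℕ) + 1) ≤ 2 * M * (k.1 : ℕ) := Nat.mul_le_mul_left _ (by omega)
    nlinarith
  · intro h
    have h0 := Fin.le_iff_val_le_val.1 h
    have h1 : 2 * M * (k.1 : ℕ) ≤ 2 * M * (c.1 : ℕ) := Nat.mul_le_mul_left _ h0
    omega

/-- `gRow₁'` is injective. [folklore] -/
theorem gRow₁'_injective : Function.Injective (gRow₁' (m₁ := m₁) (m₂ := m₂)) := by
  intro k k' h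
  unfold gRow₁' at h
  have hk := enum_lt k
  have hk' := enum_lt k'
  set M := m₁ * m₂ + 1 with hM
  have hmod : (Fintype.equivFin (Fin m₁ × Fin m₂) k : ℕ) = (Fintype.equivFin (Fin m₁ × Fin m₂) k' : ℕ) := by
    have h1 : (2 * M * (k.1 : ℕ) + (Fintype.equivFin (Fin m₁ × Fin m₂) k : ℕ)) % (2 * M) =
        (2 * M * (k'.1 : ℕ) + (Fintype.equivFin (Fin m₁ × Fin m₂) k' : ℕ)) % (2 * M) := by rw [h]
    rwa [Nat.mul_add_mod, Nat.mul_add_mod, Nat.mod_eq_of_lt (by omega : _ < 2 * M),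
      Nat.mod_eq_of_lt (by omega : _ < 2 * M)] at h1
  exact (Fintype.equivFin (Fin m₁ × Fin m₂)).injective (Fin.ext hmod)

/-- `gCol₁'` is injective. [folklore] -/
theorem gCol₁'_injective : Function.Injective (gCol₁' (m₁ := m₁) (m₂ := m₂)) := by
  intro c c' h
  unfold gCol₁' at h
  have hc := enum_lt c
  have hc' := enum_lt c'
  set M := m₁ * m₂ + 1 with hM
  have hmod : (Fintype.equivFin (Fin m₁ × Fin m₂) c : ℕ) = (Fintype.equivFin (Fin m₁ × Fin m₂) c' : ℕ) := by
    have e1 : 2 * M * (c.1 : ℕ) + (M + (Fintype.equivFin (Fin m₁ × Fin m₂) c : ℕ)) =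
        2 * M * (c.1 : ℕ) + M + (Fintype.equivFin (Fin m₁ × Fin m₂) c : ℕ) := (Nat.add_assoc _ _ _).symm
    have e2 : 2 * M * (c'.1 : ℕ) + (M + (Fintype.equivFin (Fin m₁ × Fin m₂) c' : ℕ)) =
        2 * M * (c'.1 : ℕ) + M + (Fintype.equivFin (Fin m₁ × Fin m₂) c' : ℕ) := (Nat.add_assoc _ _ _).symm
    have h1 : (2 * M * (c.1 : ℕ) + (M + (Fintype.equivFin (Fin m₁ × Fin m₂) c : ℕ))) % (2 * M) =
        (2 * M * (c'.1 : ℕ) + (M + (Fintype.equivFin (Fin m₁ × Fin m₂) c' : ℕ))) % (2 * M) := by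
      rw [e1, e2, h]
    rw [Nat.mul_add_mod, Nat.mul_add_mod, Nat.mod_eq_of_lt (by omega : _ < 2 * M),
      Nat.mod_eq_of_lt (by omega : _ < 2 * M)] at h1
    omega
  exact (Fintype.equivFin (Fin m₁ × Fin m₂)).injective (Fin.ext hmod)

/-- **The grid sum is a dominance sum** (tree coordinate `(gRow₂, gCol₂)`, bounded; staircase coordinate `(gRow₁', gCol₁')`, injective). [folklore] -/
theorem gridPts_eq_domPts (v b : Fin m₁ × Fin m₂ → (Fin 2 → ℝ)) :
    gridPts m₁ m₂ v b = domPts Finset.univ Finset.univ gRow₂ gRow₁' gCol₂ gCol₁' v b := by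
  ext x
  rw [mem_gridPts, mem_domPts]
  constructor
  · rintro ⟨k, c, h1, h2, h⟩
    exact ⟨k, Finset.mem_univ _, c, Finset.mem_univ _, (gRow₂_lt_gCol₂_iff k c).2 h2, (gRow₁'_lt_gCol₁'_iff k c).2 h1, h⟩
  · rintro ⟨k, -, c, -, h2, h1, h⟩
    exact ⟨k, c, (gRow₁'_lt_gCol₁'_iff k c).1 h1, (gRow₂_lt_gCol₂_iff k c).1 h2, h⟩

/-- **THE `log` FORM (proved):** `#vert conv(gridPts m₁ m₂ v b) ≤ 8·size(2(m₁m₂+1)(m₂+1))·(m₁m₂) = O(m₁m₂·log(m₁m₂))`. [folklore] -/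
theorem ncard_extremePoints_gridPts_le_log (v b : Fin m₁ × Fin m₂ → (Fin 2 → ℝ)) :
    ((convexHull ℝ (gridPts m₁ m₂ v b : Set (Fin 2 → ℝ))).extremePoints ℝ).ncard ≤
      8 * Nat.size (2 * (m₁ * m₂ + 1) * (m₂ + 1)) * (m₁ * m₂) := by
  classical
  rw [gridPts_eq_domPts]
  have h := ncard_extremePoints_domPts_le_size (R := (Finset.univ : Finset (Fin m₁ × Fin m₂)))
    (C := (Finset.univ : Finset (Fin m₁ × Fin m₂))) (ρ₁ := gRow₂) (γ₁ := gCol₂) (v := v) (b := b)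
    gRow₁'_injective gCol₁'_injective (2 * (m₁ * m₂ + 1) * (m₂ + 1)) fun c _ => gCol₂_lt c
  rw [Finset.card_univ, Fintype.card_prod, Fintype.card_fin, Fintype.card_fin] at h
  calc _ ≤ 4 * Nat.size (2 * (m₁ * m₂ + 1) * (m₂ + 1)) * (m₁ * m₂ + m₁ * m₂) := h
    _ = 8 * Nat.size (2 * (m₁ * m₂ + 1) * (m₂ + 1)) * (m₁ * m₂) := by ring

end Codes

end Stair

/-! ### The located rung -/

/-- **The full-grid dominance bound** (conjecture-grade, OPEN, located in memo `NOTES-t1g18.md` §3; annealed census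
`#vert/(2m₁m₂) = 1.25, 1.30` on the `4×4`, `5×5` grids): for all grid sizes and all point assignments,
`#vert conv {v k + b c : k ≤ c} ≤ C·m₁m₂`.  Its `log` form is `Stair.ncard_extremePoints_gridPts_le_log`; the general
dominance analogue ("DominanceLinear") is false asymptotically (memo §2); this grid form is what the box strata use.  Not asserted
anywhere. -/
@[conjecture] def GridDominanceBound (C : ℕ) : Prop :=
  ∀ (m₁ m₂ : ℕ) (v b : Fin m₁ × Fin m₂ → (Fin 2 → ℝ)),
    ((convexHull ℝ (Stair.gridPts m₁ m₂ v b : Set (Fin 2 → ℝ))).extremePoints ℝ).ncard ≤ C * (m₁ * m₂)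

/-- Monotonicity in the constant. -/
theorem gridDominanceBound_mono {C C' : ℕ} (hCC' : C ≤ C') (h : GridDominanceBound C) : GridDominanceBound C' :=
  fun m₁ m₂ v b => (h m₁ m₂ v b).trans (Nat.mul_le_mul_right _ hCC')

/-- `C = 0` fails (a `1 × 1` grid is one point). -/
theorem not_gridDominanceBound_zero : ¬ GridDominanceBound 0 := by
  intro h
  have h1 := h 1 1 (fun _ => 0) (fun _ => 0)
  have hne : (Stair.gridPts 1 1 (fun _ => (0 : Fin 2 → ℝ)) (fun _ => 0)).Nonempty :=
    ⟨0, Stair.mem_gridPts.2 ⟨(0, 0), (0, 0), le_rfl, le_rfl, by simp⟩⟩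
  have h2 := Literature.Computability.AlgebraicComplexity.KPTT.PlanarMinkowski.one_le_ncard_extremePoints hne
  omega

/-! ### Thin grids are linear (appended, t1g18)

Decomposing the grid by the second coordinate of the COLUMN cell, the cells with `c.2 = j` against the keys with `k.2 ≤ j` form a
one-dimensional staircase in the first coordinate; summing the staircase hull bound over `j` gives
`#vert conv(gridPts) ≤ 4(m₂ + 1)·m₁m₂`, and symmetrically `≤ 4(m₁ + 1)·m₁m₂`: `GridDominanceBound`-type bounds hold on grids with a
bounded side (constant `4(h+1)` for `min(m₁, m₂) ≤ h`), without any logarithm. -/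

namespace Stair

open Literature.Computability.AlgebraicComplexity.KPTT.PlanarMinkowski

variable {m₁ m₂ : ℕ}

/-- **Slicing by the second column coordinate:** the grid sum is the union over `j` of the staircases (first coordinate) between the keys
with `k.2 ≤ j` and the cells with `c.2 = j`. [folklore] -/
theorem gridPts_eq_biUnion_snd [DecidableEq (Fin 2 → ℝ)] (v b : Fin m₁ × Fin m₂ → (Fin 2 → ℝ)) :
    gridPts m₁ m₂ v b = (Finset.univ : Finset (Fin m₂)).biUnion fun j =>
      stairPts (Finset.univ.filter fun k : Fin m₁ × Fin m₂ => k.2 ≤ j) (Finset.univ.filter fun c : Fin m₁ × Fin m₂ => c.2 = j)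
        gRow₁' gCol₁' v b := by
  ext x
  rw [mem_gridPts, Finset.mem_biUnion]
  constructor
  · rintro ⟨k, c, h1, h2, h⟩
    refine ⟨c.2, Finset.mem_univ _, mem_stairPts.2 ⟨k, Finset.mem_filter.2 ⟨Finset.mem_univ _, h2⟩, c,
      Finset.mem_filter.2 ⟨Finset.mem_univ _, rfl⟩, (gRow₁'_lt_gCol₁'_iff k c).2 h1, h⟩⟩
  · rintro ⟨j, -, hx⟩
    obtain ⟨k, hk, c, hc, hlt, h⟩ := mem_stairPts.1 hx
    have hk2 := (Finset.mem_filter.1 hk).2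
    have hc2 := (Finset.mem_filter.1 hc).2
    exact ⟨k, c, (gRow₁'_lt_gCol₁'_iff k c).1 hlt, by rw [hc2]; exact hk2, h⟩

/-- **Slicing by the first column coordinate** (the symmetric decomposition, staircases in the second coordinate). [folklore] -/
theorem gridPts_eq_biUnion_fst [DecidableEq (Fin 2 → ℝ)] (v b : Fin m₁ × Fin m₂ → (Fin 2 → ℝ)) :
    gridPts m₁ m₂ v b = (Finset.univ : Finset (Fin m₁)).biUnion fun i =>
      stairPts (Finset.univ.filter fun k : Fin m₁ × Fin m₂ => k.1 ≤ i) (Finset.univ.filter fun c : Fin m₁ × Fin m₂ => c.1 = i)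
        gRow₂ gCol₂ v b := by
  ext x
  rw [mem_gridPts, Finset.mem_biUnion]
  constructor
  · rintro ⟨k, c, h1, h2, h⟩
    refine ⟨c.1, Finset.mem_univ _, mem_stairPts.2 ⟨k, Finset.mem_filter.2 ⟨Finset.mem_univ _, h1⟩, c,
      Finset.mem_filter.2 ⟨Finset.mem_univ _, rfl⟩, (gRow₂_lt_gCol₂_iff k c).2 h2, h⟩⟩
  · rintro ⟨i, -, hx⟩
    obtain ⟨k, hk, c, hc, hlt, h⟩ := mem_stairPts.1 hx
    have hk1 := (Finset.mem_filter.1 hk).2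
    have hc1 := (Finset.mem_filter.1 hc).2
    exact ⟨k, c, by rw [hc1]; exact hk1, (gRow₂_lt_gCol₂_iff k c).1 hlt, h⟩

/-- The cells with a fixed second coordinate number at most `m₁`. [folklore] -/
theorem card_filter_snd_eq_le (j : Fin m₂) :
    ((Finset.univ : Finset (Fin m₁ × Fin m₂)).filter fun c => c.2 = j).card ≤ m₁ := by
  classical
  calc ((Finset.univ : Finset (Fin m₁ × Fin m₂)).filter fun c => c.2 = j).card
      ≤ (Finset.univ : Finset (Fin m₁)).card := by
        refine Finset.card_le_card_of_injOn (fun c => c.1) (fun c _ => Finset.mem_coe.2 (Finset.mem_univ _)) ?_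
        intro c hc c' hc' h
        have e := (Finset.mem_filter.1 (Finset.mem_coe.1 hc)).2
        have e' := (Finset.mem_filter.1 (Finset.mem_coe.1 hc')).2
        exact Prod.ext h (e.trans e'.symm)
    _ = m₁ := by rw [Finset.card_univ, Fintype.card_fin]

/-- The cells with a fixed first coordinate number at most `m₂`. [folklore] -/
theorem card_filter_fst_eq_le (i : Fin m₁) :
    ((Finset.univ : Finset (Fin m₁ × Fin m₂)).filter fun c => c.1 = i).card ≤ m₂ := by
  classical
  calc ((Finset.univ : Finset (Fin m₁ × Fin m₂)).filter fun c => c.1 = i).card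
      ≤ (Finset.univ : Finset (Fin m₂)).card := by
        refine Finset.card_le_card_of_injOn (fun c => c.2) (fun c _ => Finset.mem_coe.2 (Finset.mem_univ _)) ?_
        intro c hc c' hc' h
        have e := (Finset.mem_filter.1 (Finset.mem_coe.1 hc)).2
        have e' := (Finset.mem_filter.1 (Finset.mem_coe.1 hc')).2
        exact Prod.ext (e.trans e'.symm) h
    _ = m₂ := by rw [Finset.card_univ, Fintype.card_fin]

/-- **THIN GRIDS ARE LINEAR, I:** `#vert conv(gridPts m₁ m₂ v b) ≤ 4(m₂ + 1)·(m₁m₂)` (no logarithm; the bound of choice when `m₂` is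
bounded). [folklore] -/
theorem ncard_extremePoints_gridPts_le_snd (v b : Fin m₁ × Fin m₂ → (Fin 2 → ℝ)) :
    ((convexHull ℝ (gridPts m₁ m₂ v b : Set (Fin 2 → ℝ))).extremePoints ℝ).ncard ≤ 4 * (m₂ + 1) * (m₁ * m₂) := by
  classical
  rw [gridPts_eq_biUnion_snd]
  refine (ncard_extremePoints_biUnion_le _ _).trans ?_
  have hj : ∀ j ∈ (Finset.univ : Finset (Fin m₂)),
      ((convexHull ℝ (stairPts (Finset.univ.filter fun k : Fin m₁ × Fin m₂ => k.2 ≤ j)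
        (Finset.univ.filter fun c : Fin m₁ × Fin m₂ => c.2 = j) gRow₁' gCol₁' v b : Set (Fin 2 → ℝ))).extremePoints ℝ).ncard ≤
        4 * (m₁ * m₂ + m₁) := by
    intro j _
    refine (ncard_extremePoints_stairPts_le gRow₁'_injective gCol₁'_injective).trans (Nat.mul_le_mul_left 4 (add_le_add ?_ ?_))
    · calc (Finset.univ.filter fun k : Fin m₁ × Fin m₂ => k.2 ≤ j).card ≤ (Finset.univ : Finset (Fin m₁ × Fin m₂)).card :=
            Finset.card_le_card (Finset.filter_subset _ _)
        _ = m₁ * m₂ := by rw [Finset.card_univ, Fintype.card_prod, Fintype.card_fin, Fintype.card_fin]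
    · exact card_filter_snd_eq_le j
  refine (Finset.sum_le_sum hj).trans ?_
  rw [Finset.sum_const, Finset.card_univ, Fintype.card_fin, smul_eq_mul]
  nlinarith [Nat.zero_le m₁, Nat.zero_le m₂]

/-- **THIN GRIDS ARE LINEAR, II:** `#vert conv(gridPts m₁ m₂ v b) ≤ 4(m₁ + 1)·(m₁m₂)`. [folklore] -/
theorem ncard_extremePoints_gridPts_le_fst (v b : Fin m₁ × Fin m₂ → (Fin 2 → ℝ)) :
    ((convexHull ℝ (gridPts m₁ m₂ v b : Set (Fin 2 → ℝ))).extremePoints ℝ).ncard ≤ 4 * (m₁ + 1) * (m₁ * m₂) := by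
  classical
  rw [gridPts_eq_biUnion_fst]
  refine (ncard_extremePoints_biUnion_le _ _).trans ?_
  have hi : ∀ i ∈ (Finset.univ : Finset (Fin m₁)),
      ((convexHull ℝ (stairPts (Finset.univ.filter fun k : Fin m₁ × Fin m₂ => k.1 ≤ i)
        (Finset.univ.filter fun c : Fin m₁ × Fin m₂ => c.1 = i) gRow₂ gCol₂ v b : Set (Fin 2 → ℝ))).extremePoints ℝ).ncard ≤
        4 * (m₁ * m₂ + m₂) := by
    intro i _
    refine (ncard_extremePoints_stairPts_le gRow₂_injective gCol₂_injective).trans (Nat.mul_le_mul_left 4 (add_le_add ?_ ?_))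
    · calc (Finset.univ.filter fun k : Fin m₁ × Fin m₂ => k.1 ≤ i).card ≤ (Finset.univ : Finset (Fin m₁ × Fin m₂)).card :=
            Finset.card_le_card (Finset.filter_subset _ _)
        _ = m₁ * m₂ := by rw [Finset.card_univ, Fintype.card_prod, Fintype.card_fin, Fintype.card_fin]
    · exact card_filter_fst_eq_le i
  refine (Finset.sum_le_sum hi).trans ?_
  rw [Finset.sum_const, Finset.card_univ, Fintype.card_fin, smul_eq_mul]
  nlinarith [Nat.zero_le m₁, Nat.zero_le m₂]

/-- **Thin grids:** `#vert conv(gridPts) ≤ 4(min(m₁, m₂) + 1)·m₁m₂`. [folklore] -/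
theorem ncard_extremePoints_gridPts_le_min (v b : Fin m₁ × Fin m₂ → (Fin 2 → ℝ)) :
    ((convexHull ℝ (gridPts m₁ m₂ v b : Set (Fin 2 → ℝ))).extremePoints ℝ).ncard ≤ 4 * (min m₁ m₂ + 1) * (m₁ * m₂) := by
  rcases le_total m₁ m₂ with h | h
  · rw [min_eq_left h]; exact ncard_extremePoints_gridPts_le_fst v b
  · rw [min_eq_right h]; exact ncard_extremePoints_gridPts_le_snd v b

end Stair

end TotalsLaw

end Summit.ValiantsHypothesis.ValiantsHypothesis.Theorems.NewtonUnitEquationsDissociatedUniform
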